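import Literature.MathematicalPhysics.QuantumLattice.AnisotropicSectors
import HarnessLib

/-!
# The angular sector cutoff through the angle relative to the sector centre

Topic `Literature/MathematicalPhysics/QuantumLattice`; continues `SectorPartitionOfUnityCircle.lean`
(`ζ̃_{n,ω} = sectorWeightCirc n ω`, the `2π`-periodised angular cutoff of the sector `ω` at scale
`h = -n`, centre `θ_{n,ω} = (ω + ½) w_n`, width `w_n = π 2^{-n}`) and `AnisotropicSectors.lean`
(`polarAngle k⃗ = arg(k₁ + ik₂)`).

For the `h`-uniform estimates of the sector propagators (BGM 2006, Lemma 2.2) the angular cutoff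
must be written through an `h`-INDEPENDENT profile of the rescaled angle: measuring angles
relative to the centre, `Θ = arg((k₁ + ik₂) e^{-iθ_{n,ω}}) ∈ (-π, π]`, the periodisation collapses
to a single term,

  `ζ̃_{n,ω}(θ(k⃗)) = W(Θ / w_n)`,  `W = sectorUnitWeight` (`= 1` on `|r| ≤ ¼`, `= 0` for `|r| ≥ ¾`),

for every `k⃗ ≠ 0` (`sectorWeightCirc_polarAngle_eq`): the translate through the representative
`θ_{n,ω} + Θ + 2πm` of `θ(k⃗)` is `W(Θ/w_n)` and all the other translates are centred at distance
`≥ 2π - |Θ| ≥ π ≥ ¾w_n`. PROVED: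

* `sectorWeightCirc_center_add` — `ζ̃_{n,ω}(θ_{n,ω} + Θ + 2πm) = W(Θ/w_n)` for `|Θ| ≤ π`;
* `sectorRelAngle θ₀ k⃗ = arg((k₁+ik₂)e^{-iθ₀})`, `polarAngle_eq_add_sectorRelAngle` — `θ(k⃗) = θ₀ + Θ + 2πm`;
* `sectorWeightCirc_polarAngle_eq` — the displayed identity.

Everything is PROVED; the only definition is `sectorRelAngle`.

## Sources

* G. Benfatto, A. Giuliani, V. Mastropietro, Ann. Henri Poincaré 7 (2006) 809–898, §2.5 (2.45)
  and Lemma 2.2. [BenfattoGiulianiMastropietro2006]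
-/

noncomputable section

open Real Set Complex
open scoped Topology

namespace Literature.MathematicalPhysics.QuantumLattice

/-! ### Collapse of the periodisation at the centre -/

/-- The `m`-th translate at `θ_{n,ω} + Θ + 2πm` is `W(Θ/w_n)`. [folklore] -/
theorem sectorWeight_translate_center_add (n : ℕ) (ω m : ℤ) (Θ : ℝ) :
    sectorWeight n (ω + m * sectorCount n) (((ω : ℝ) + 1 / 2) * sectorWidth n + Θ + 2 * π * m) =
      sectorUnitWeight (Θ / sectorWidth n) := by
  have hw := sectorWidth_pos n
  have hN := sectorCount_mul_sectorWidth n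
  have h2pm : 2 * π * (m : ℝ) = (m : ℝ) * sectorCount n * sectorWidth n := by
    linear_combination (-(m : ℝ)) * hN
  rw [sectorWeight, h2pm]
  congr 1
  push_cast
  field_simp
  ring

/-- **Collapse of the periodisation**: `ζ̃_{n,ω}(θ_{n,ω} + Θ + 2πm) = W(Θ/w_n)` for `|Θ| ≤ π`. [cite: BenfattoGiulianiMastropietro2006, §2.5 (2.45)] -/
theorem sectorWeightCirc_center_add (n : ℕ) (ω m : ℤ) {Θ : ℝ} (hΘ : |Θ| ≤ π) :
    sectorWeightCirc n ω (((ω : ℝ) + 1 / 2) * sectorWidth n + Θ + 2 * π * m) =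
      sectorUnitWeight (Θ / sectorWidth n) := by
  have hwπ := sectorWidth_le_pi n
  unfold sectorWeightCirc
  rw [tsum_eq_single m]
  · exact sectorWeight_translate_center_add n ω m Θ
  · intro k hk
    apply sectorWeight_translate_eq_zero
    have h1 : (1 : ℝ) ≤ |((m : ℝ) - k)| := by
      rw [← Int.cast_sub]; exact_mod_cast Int.one_le_abs (sub_ne_zero.2 (Ne.symm hk))
    have h2 : ((ω : ℝ) + 1 / 2) * sectorWidth n + Θ + 2 * π * m - ((ω : ℝ) + 1 / 2) * sectorWidth n - 2 * π * k =
        Θ + 2 * π * ((m : ℝ) - k) := by ring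
    rw [h2]
    have h3 : |Θ + 2 * π * ((m : ℝ) - k)| ≥ 2 * π * |((m : ℝ) - k)| - |Θ| := by
      have := abs_sub_abs_le_abs_sub (2 * π * ((m : ℝ) - k)) (-Θ)
      rw [abs_mul, abs_of_pos two_pi_pos, abs_neg, show 2 * π * ((m : ℝ) - k) - -Θ = Θ + 2 * π * ((m : ℝ) - k) by ring] at this
      linarith
    nlinarith [pi_pos, h1, h3]

/-! ### The angle relative to a centre -/

/-- **The angle of `k⃗` relative to the direction `θ₀`**: `Θ = arg((k₁ + ik₂) e^{-iθ₀}) ∈ (-π, π]`. [folklore] -/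
def sectorRelAngle (θ₀ : ℝ) (k : Fin 2 → ℝ) : ℝ := arg (momToComplex k * exp (-(θ₀ * I)))

/-- `|Θ| ≤ π`. [folklore] -/
theorem abs_sectorRelAngle_le (θ₀ : ℝ) (k : Fin 2 → ℝ) : |sectorRelAngle θ₀ k| ≤ π :=
  abs_arg_le_pi _

/-- **`θ(k⃗) = θ₀ + Θ + 2πm`** for some integer `m` (`k⃗ ≠ 0`). [folklore] -/
theorem polarAngle_eq_add_sectorRelAngle (θ₀ : ℝ) {k : Fin 2 → ℝ} (hk : k ≠ 0) :
    ∃ m : ℤ, polarAngle k = θ₀ + sectorRelAngle θ₀ k + 2 * π * m := by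
  have hz : momToComplex k ≠ 0 := fun h => hk ((momToComplex_eq_zero_iff k).1 h)
  have he : exp (-(θ₀ * I)) ≠ 0 := exp_ne_zero _
  -- `arg (z e^{-iθ₀}) ≡ arg z - θ₀ (mod 2π)`
  have h1 : ((arg (momToComplex k * exp (-(θ₀ * I))) : Real.Angle)) =
      (arg (momToComplex k) : Real.Angle) + (arg (exp (-(θ₀ * I))) : Real.Angle) :=
    arg_mul_coe_angle hz he
  have h2 : ((arg (exp (-(θ₀ * I)))) : Real.Angle) = ((-θ₀ : ℝ) : Real.Angle) := by
    rw [show -(θ₀ * I) = ((-θ₀ : ℝ) : ℂ) * I by push_cast; ring, arg_exp_mul_I]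
    exact Real.Angle.coe_toIocMod _ _
  rw [h2] at h1
  -- unfold the equality of angles
  have h3 : ((polarAngle k - θ₀ - sectorRelAngle θ₀ k : ℝ) : Real.Angle) = 0 := by
    rw [sectorRelAngle, polarAngle, Real.Angle.coe_sub, Real.Angle.coe_sub, h1, Real.Angle.coe_neg]
    abel
  obtain ⟨m, hm⟩ := Real.Angle.coe_eq_zero_iff.1 h3
  refine ⟨m, ?_⟩
  rw [zsmul_eq_mul] at hm
  linarith

/-- **The angular sector cutoff through the relative angle**:
`ζ̃_{n,ω}(θ(k⃗)) = W(Θ_{n,ω}(k⃗) / w_n)` for `k⃗ ≠ 0`, `Θ_{n,ω}` the angle relative to the centre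
`θ_{n,ω} = (ω + ½) w_n` and `W = sectorUnitWeight` — an `n`-independent profile of the rescaled
relative angle. [cite: BenfattoGiulianiMastropietro2006, §2.5 (2.45)] -/
theorem sectorWeightCirc_polarAngle_eq (n : ℕ) (ω : ℤ) {k : Fin 2 → ℝ} (hk : k ≠ 0) :
    sectorWeightCirc n ω (polarAngle k) =
      sectorUnitWeight (sectorRelAngle (((ω : ℝ) + 1 / 2) * sectorWidth n) k / sectorWidth n) := by
  obtain ⟨m, hm⟩ := polarAngle_eq_add_sectorRelAngle (((ω : ℝ) + 1 / 2) * sectorWidth n) hk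
  rw [hm]
  exact sectorWeightCirc_center_add n ω m (abs_sectorRelAngle_le _ _)

end Literature.MathematicalPhysics.QuantumLattice

end
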